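import HarnessLib
import Summits.CriticalPhenomena.Ising3DConformalLimit.Theorems.HyperoctahedralRPTwoPointKernelOfLimit
import Summits.CriticalPhenomena.Ising3DConformalLimit.Theorems.HarmonicMomentsIsotropyTwoPointAsymptoticIsotropyArityLimit

/-!
# Vague asymptotic isotropy of the critical `ℤ³` two-point function, XI:
# the kernel of a PAIR scaling limit — continuity, nine-mirror invariance and reflection positivity
(route HarmonicMomentsIsotropy, support item stmt-CriticalPhenomena-6036 `TwoPointAsymptoticIsotropy`;
second file of the pair-only conditional line)

Let the renormalised critical PAIR correlator of the nearest-neighbour Ising model on `ℤ³` converge,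
`TendstoLocallyUniformlyOn (rescaledCorrelator (criticalCorr 3) ρ 2) S₂ (𝓝[>] 0) (NonCoincident 3 2)`
(any renormalisation `ρ`, nothing assumed about the higher correlators), and put `K x = S₂ (0, x)`.
This file proves the pair-only forms of clauses (b), (e), (f) of the tree's `TwoPointKernelOfLimit`
(route HyperoctahedralRP, `…HyperoctahedralRPTwoPointKernelOfLimit{Clauses,}`):

* `limit_two_eq_of_sub₂` — `S₂(p, q) = K(q − p)` (`limit_translate_arity`);
* `kernel_continuousOn₂` — `K` is continuous off `0` (`limit_continuousOn_arity`);
* `kernel_mirror_invariant₂` — `K ∘ θ_n = K` for the nine lattice mirror normals `n ∈ {e_i, e_i ± e_j}`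
  (signed permutations, `limit_signedPerm_arity`);
* `kernel_mirrorRP_of_latticeRP₂` and `kernel_nineMirror₂` — `Σ c_a c_b K(p_a − θ_n p_b) ≥ 0` for points
  of the open half-space `⟨·, n⟩ > 0`: lattice reflection positivity for the nine mirrors
  (`criticalCorrNineMirrorRP_proof`, FILS 1978, via `latticeRP_two_of_nine`) passed to the limit through
  the automatic continuity of `S₂`.

The proofs are those of the tree with the full-limit hypothesis `HasPointwiseScalingLimit` replaced by
the pair convergence; together with the automatic homogeneity (file XII) they feed nine-mirror RP
rigidity (`HRP2Rigidity_of`) in the pair-only conditional theorem `twoPointAsymptoticIsotropy_of_pairLimit`.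

References: J. Fröhlich, R. Israel, E. H. Lieb, B. Simon, Comm. Math. Phys. 62 (1978), §3 Thm. 3.1
[FrohlichEtAl1978]; J. Glimm, A. Jaffe, *Quantum Physics* (1987), §10.4 [GlimmJaffeQP1987];
S. Friedli, Y. Velenik (CUP 2017), Thm. 3.17, Exercise 3.14 [FriedliVelenik2017]. No definitions are
introduced.
-/

noncomputable section

namespace Summit.CriticalPhenomena.Ising3DConformalLimit.HarmonicMomentsIsotropyTwoPoint

open Literature.Probability.LatticeModels Literature.MathematicalPhysics.QuantumFieldTheory
open Filter Set
open scoped Topology InnerProductSpace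
open Summit.CriticalPhenomena.Ising3DConformalLimit.MoebiusLimitExistsNegative
open Summit.CriticalPhenomena.Ising3DConformalLimit.RotationUpgradeFromTwoPointNegative
open Summit.CriticalPhenomena.Ising3DConformalLimit.HyperoctahedralRPTwoPoint
open Summit.CriticalPhenomena.Ising3DConformalLimit.HyperoctahedralRPNineMirror

variable {ρ : ℝ → ℝ} {S2 : (Fin 2 → EuclideanSpace ℝ (Fin 3)) → ℝ}

/-! ### The kernel is a function of the difference; continuity -/

/-- The pair limit is a function of the difference only: `S₂(p, q) = S₂(0, q − p)` for `p ≠ q`.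
[cite: FriedliVelenik2017, Thm. 3.17] -/
theorem limit_two_eq_of_sub₂
    (hlim2 : TendstoLocallyUniformlyOn (rescaledCorrelator (criticalCorr 3) ρ 2) S2 (𝓝[>] (0:ℝ))
      (NonCoincident 3 2))
    {p q : EuclideanSpace ℝ (Fin 3)} (hpq : p ≠ q) :
    S2 ![p, q] = S2 ![0, q - p] := by
  have hmem : (![0, q - p] : Fin 2 → EuclideanSpace ℝ (Fin 3)) ∈ NonCoincident 3 2 :=
    zero_pair_mem_nonCoincident (sub_ne_zero.2 hpq.symm)
  have h := limit_translate_arity hlim2 p hmem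
  have hcfg : (fun i => (![0, q - p] : Fin 2 → EuclideanSpace ℝ (Fin 3)) i + p) = ![p, q] := by
    funext i; fin_cases i <;> simp
  rw [hcfg] at h
  exact h

/-- (b) The kernel `x ↦ S₂ (0, x)` of a pair limit is continuous off the origin.
[cite: FriedliVelenik2017, Thm. 3.17] -/
theorem kernel_continuousOn₂
    (hlim2 : TendstoLocallyUniformlyOn (rescaledCorrelator (criticalCorr 3) ρ 2) S2 (𝓝[>] (0:ℝ))
      (NonCoincident 3 2)) :
    ContinuousOn (fun x : EuclideanSpace ℝ (Fin 3) => S2 ![0, x]) {0}ᶜ :=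
  (limit_continuousOn_arity hlim2).comp continuous_zeroPair.continuousOn
    fun _ hx => zero_pair_mem_nonCoincident hx

/-! ### (e) Invariance under the nine lattice mirrors -/

/-- (e) The kernel of a pair limit is invariant under the nine lattice mirrors `e_i`, `e_i ± e_j`
(the reflections are signed coordinate permutations). [cite: FriedliVelenik2017, Exercise 3.14, p. 115] -/
theorem kernel_mirror_invariant₂
    (hlim2 : TendstoLocallyUniformlyOn (rescaledCorrelator (criticalCorr 3) ρ 2) S2 (𝓝[>] (0:ℝ))
      (NonCoincident 3 2))
    {n : EuclideanSpace ℝ (Fin 3)}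
    (hn : ∃ i j : Fin 3, i ≠ j ∧ (n = EuclideanSpace.single i 1 ∨
      n = EuclideanSpace.single i 1 + EuclideanSpace.single j 1 ∨
      n = EuclideanSpace.single i 1 - EuclideanSpace.single j 1))
    (x : EuclideanSpace ℝ (Fin 3)) :
    S2 ![0, (ℝ ∙ n)ᗮ.reflection x] = S2 ![0, x] := by
  by_cases hx : x = 0
  · subst hx
    simp
  obtain ⟨π, ε, hR⟩ := exists_signedPerm_of_latticeNormal hn
  have h := limit_signedPerm_arity hlim2 π ε ((ℝ ∙ n)ᗮ.reflection) hR (zero_pair_mem_nonCoincident hx)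
  rwa [comp_zeroPair (map_zero _)] at h

/-! ### (f) Lattice reflection positivity passes to the pair limit -/

/-- **Lattice reflection positivity passes to a pair limit.** If the critical lattice two-point
function is reflection positive for a lattice realisation `θ'` of the mirror `θ_n` on finite families
of sites strictly inside the integer half-space `{ℓ > 0}` realising `⟨·, n⟩ > 0`, then the kernel of any
pair limit satisfies `Σ c_a c_b S₂(0, p_a − θ_n p_b) ≥ 0` for points of the open half-space
(approximation of `p_a` by rescaled sites, `ρ(δ)² ≥ 0`, and passage to the limit through the
automatic continuity of `S₂`). [cite: GlimmJaffeQP1987, §10.4, Remark after Thm. 10.4.3] -/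
theorem kernel_mirrorRP_of_latticeRP₂
    (hlim2 : TendstoLocallyUniformlyOn (rescaledCorrelator (criticalCorr 3) ρ 2) S2 (𝓝[>] (0:ℝ))
      (NonCoincident 3 2))
    (n : EuclideanSpace ℝ (Fin 3)) (θ' : Site 3 → Site 3) (ℓ : Site 3 → ℤ)
    (hθ' : ∀ y, siteVec (θ' y) = (ℝ ∙ n)ᗮ.reflection (siteVec y))
    (hℓ : ∀ y, (ℓ y : ℝ) = ⟪siteVec y, n⟫_ℝ)
    (hRP : ∀ (m : ℕ) (y : Fin m → Site 3) (c : Fin m → ℝ), (∀ a, 0 < ℓ (y a)) →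
      0 ≤ ∑ a, ∑ b, c a * c b * criticalCorr 3 2 ![θ' (y a), y b])
    (m : ℕ) (p : Fin m → EuclideanSpace ℝ (Fin 3)) (c : Fin m → ℝ)
    (hp : ∀ a, 0 < ⟪p a, n⟫_ℝ) :
    0 ≤ ∑ a, ∑ b, c a * c b * S2 ![0, p a - (ℝ ∙ n)ᗮ.reflection (p b)] := by
  set θ := (ℝ ∙ n)ᗮ.reflection with hθdef
  -- the reflected points lie strictly on the other side
  have hne : ∀ a b, θ (p a) ≠ p b := by
    intro a b h
    have h1 : ⟪θ (p a), n⟫_ℝ = -⟪p a, n⟫_ℝ := inner_mirrorReflection_normal n (p a)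
    have h2 := hp a
    have h3 := hp b
    rw [h] at h1
    linarith
  -- Step 1: the target sum is `Σ c_a c_b S₂ (θ p_a, p_b)`
  have hsum : ∑ a, ∑ b, c a * c b * S2 ![0, p a - θ (p b)] =
      ∑ a, ∑ b, c a * c b * S2 ![θ (p a), p b] := by
    rw [Finset.sum_comm]
    refine Finset.sum_congr rfl fun a _ => Finset.sum_congr rfl fun b _ => ?_
    rw [limit_two_eq_of_sub₂ hlim2 (hne a b), mul_comm (c b) (c a)]
  rw [hsum]
  -- Step 2: the approximants and their limits
  set y : ℝ → Fin m → Site 3 := fun δ a => latticeApprox δ (p a) with hy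
  set T : ℝ → Fin m → Fin m → ℝ := fun δ a b =>
    rescaledCorrelator (criticalCorr 3) ρ 2 δ
      (![δ • siteVec (θ' (y δ a)), δ • siteVec (y δ b)] : Fin 2 → EuclideanSpace ℝ (Fin 3)) with hT
  have hTlim : ∀ a b, Tendsto (fun δ => T δ a b) (𝓝[>] (0:ℝ)) (𝓝 (S2 ![θ (p a), p b])) := by
    intro a b
    have hmem : (![θ (p a), p b] : Fin 2 → EuclideanSpace ℝ (Fin 3)) ∈ NonCoincident 3 2 :=
      HyperoctahedralRPTwoPoint.pair_mem_nonCoincident (hne a b)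
    have hcont : ContinuousWithinAt S2 (NonCoincident 3 2) ![θ (p a), p b] :=
      limit_continuousOn_arity hlim2 _ hmem
    have ha : Tendsto (fun δ : ℝ => δ • siteVec (θ' (y δ a))) (𝓝[>] (0:ℝ)) (𝓝 (θ (p a))) := by
      have h1 : ∀ δ : ℝ, δ • siteVec (θ' (y δ a)) = θ (δ • siteVec (y δ a)) := fun δ => by
        rw [hθ', LinearIsometryEquiv.map_smul]
      simp_rw [h1]
      exact (θ.continuous.tendsto _).comp (tendsto_smul_siteVec_latticeApprox (p a))
    have hb : Tendsto (fun δ : ℝ => δ • siteVec (y δ b)) (𝓝[>] (0:ℝ)) (𝓝 (p b)) :=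
      tendsto_smul_siteVec_latticeApprox (p b)
    have hZ : Tendsto (fun δ : ℝ =>
        (![δ • siteVec (θ' (y δ a)), δ • siteVec (y δ b)] : Fin 2 → EuclideanSpace ℝ (Fin 3)))
        (𝓝[>] (0:ℝ)) (𝓝 ![θ (p a), p b]) := by
      rw [tendsto_pi_nhds]
      intro i
      fin_cases i
      · simpa using ha
      · simpa using hb
    have hZ' : Tendsto (fun δ : ℝ =>
        (![δ • siteVec (θ' (y δ a)), δ • siteVec (y δ b)] : Fin 2 → EuclideanSpace ℝ (Fin 3)))
        (𝓝[>] (0:ℝ)) (𝓝[NonCoincident 3 2] ![θ (p a), p b]) :=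
      tendsto_nhdsWithin_of_tendsto_nhds_of_eventually_within _ hZ
        (hZ.eventually ((isOpen_nonCoincident 3 2).mem_nhds hmem))
    exact hlim2.tendsto_comp hcont hmem hZ'
  -- Step 3: eventually every lattice point is strictly on the positive side
  have hpos : ∀ᶠ δ in 𝓝[>] (0:ℝ), ∀ a, 0 < ℓ (y δ a) := by
    refine eventually_all.2 fun a => ?_
    have hcont : Continuous fun q : EuclideanSpace ℝ (Fin 3) => ⟪q, n⟫_ℝ :=
      continuous_id.inner continuous_const
    have ht : Tendsto (fun δ : ℝ => ⟪δ • siteVec (y δ a), n⟫_ℝ) (𝓝[>] (0:ℝ)) (𝓝 ⟪p a, n⟫_ℝ) :=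
      (hcont.tendsto _).comp (tendsto_smul_siteVec_latticeApprox (p a))
    filter_upwards [ht.eventually (lt_mem_nhds (hp a)), self_mem_nhdsWithin] with δ hδ hδpos
    rw [real_inner_smul_left, ← hℓ] at hδ
    have h' : (0:ℝ) < ℓ (y δ a) := pos_of_mul_pos_right hδ (le_of_lt hδpos)
    exact_mod_cast h'
  -- Step 4: eventually the approximating sums are `ρ(δ)² · (lattice RP sum) ≥ 0`
  have hTsum : ∀ᶠ δ in 𝓝[>] (0:ℝ), 0 ≤ ∑ a, ∑ b, c a * c b * T δ a b := by
    filter_upwards [hpos, self_mem_nhdsWithin] with δ hδ hδpos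
    have hrw : ∑ a, ∑ b, c a * c b * T δ a b =
        ρ δ ^ 2 * ∑ a, ∑ b, c a * c b * criticalCorr 3 2 ![θ' (y δ a), y δ b] := by
      rw [Finset.mul_sum]
      refine Finset.sum_congr rfl fun a _ => ?_
      rw [Finset.mul_sum]
      refine Finset.sum_congr rfl fun b _ => ?_
      rw [hT]
      simp only []
      rw [rescaledCorrelator_two_smul_siteVec ρ hδpos]
      ring
    rw [hrw]
    exact mul_nonneg (sq_nonneg _) (hRP m (y δ) c hδ)
  -- Step 5: pass to the limit
  have hlimsum : Tendsto (fun δ => ∑ a, ∑ b, c a * c b * T δ a b) (𝓝[>] (0:ℝ))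
      (𝓝 (∑ a, ∑ b, c a * c b * S2 ![θ (p a), p b])) :=
    tendsto_finsetSum _ fun a _ => tendsto_finsetSum _ fun b _ => (hTlim a b).const_mul _
  exact ge_of_tendsto hlimsum hTsum

/-- **The kernel of ANY pair scaling limit of the critical `ℤ³` Ising two-point function is invariant
and reflection positive with respect to each of the nine lattice mirrors `e_i, e_i ± e_j`** — whatever
the renormalisation, with no non-degeneracy or covariance hypothesis and no control of the higher
correlators: lattice reflection positivity (FILS 1978, `criticalCorrNineMirrorRP_proof`) passes to the
limit. This is the `hmirror` input of nine-mirror RP rigidity `HRP2Rigidity_of`.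
[cite: FrohlichEtAl1978, §3 Thm 3.1] -/
theorem kernel_nineMirror₂
    (hlim2 : TendstoLocallyUniformlyOn (rescaledCorrelator (criticalCorr 3) ρ 2) S2 (𝓝[>] (0:ℝ))
      (NonCoincident 3 2))
    {n : EuclideanSpace ℝ (Fin 3)}
    (hn : ∃ i j : Fin 3, i ≠ j ∧ (n = EuclideanSpace.single i 1 ∨
      n = EuclideanSpace.single i 1 + EuclideanSpace.single j 1 ∨
      n = EuclideanSpace.single i 1 - EuclideanSpace.single j 1)) :
    (∀ x : EuclideanSpace ℝ (Fin 3), S2 ![0, (ℝ ∙ n)ᗮ.reflection x] = S2 ![0, x]) ∧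
    (∀ (m : ℕ) (p : Fin m → EuclideanSpace ℝ (Fin 3)) (c : Fin m → ℝ), (∀ a, 0 < inner ℝ (p a) n) →
      0 ≤ ∑ a, ∑ b, c a * c b * S2 ![0, p a - (ℝ ∙ n)ᗮ.reflection (p b)]) := by
  refine ⟨kernel_mirror_invariant₂ hlim2 hn, ?_⟩
  have hNine := criticalCorrNineMirrorRP_proof
  obtain ⟨i, j, hij, rfl | rfl | rfl⟩ := hn
  · exact kernel_mirrorRP_of_latticeRP₂ hlim2 _ (fun y => Function.update y i (-y i)) (fun y => y i)
      (siteVec_coordMirror i) (level_coordMirror i)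
      (latticeRP_two_of_nine hNine _ _ ⟨i, j, hij, Or.inl ⟨rfl, rfl⟩⟩)
  · exact kernel_mirrorRP_of_latticeRP₂ hlim2 _
      (fun y => Function.update (Function.update y i (-y j)) j (-y i)) (fun y => y i + y j)
      (siteVec_antiMirror hij) (level_antiMirror i j)
      (latticeRP_two_of_nine hNine _ _ ⟨i, j, hij, Or.inr (Or.inr ⟨rfl, rfl⟩)⟩)
  · exact kernel_mirrorRP_of_latticeRP₂ hlim2 _ (fun y => y ∘ Equiv.swap i j) (fun y => y i - y j)
      (siteVec_swapMirror hij) (level_swapMirror i j)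
      (latticeRP_two_of_nine hNine _ _ ⟨i, j, hij, Or.inr (Or.inl ⟨rfl, rfl⟩)⟩)

end Summit.CriticalPhenomena.Ising3DConformalLimit.HarmonicMomentsIsotropyTwoPoint

end
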